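import Summits.Ventures.LatticeQCDFlow.Scoring.AlternantPowerSumCoefficients
import Summits.Ventures.LatticeQCDFlow.Scoring.TorusParsevalAlternant
import Summits.Ventures.LatticeQCDFlow.Scoring.TorusParsevalPairing
import Summits.Ventures.LatticeQCDFlow.Scoring.UNTraceMomentsCentralPhase
import Summits.Ventures.LatticeQCDFlow.Scoring.OneColumnTableaux
import Summits.Ventures.LatticeQCDFlow.Scoring.UNOnePlaquetteCumulants
import Summits.Ventures.LatticeQCDFlow.Scoring.GrossWittenPartitionFunctionHaar
import HarnessLib

/-!
# The even trace moments of a Haar unitary are tableau counts — `∫_{U(N)} |tr U|^{2n} dU = n!` for `n ≤ N` — and the strong-coupling expansion of 2-d `U(N)` lattice gauge theory is Gaussian through order `2N + 1`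

HONEST FRAMING: exact (Metropolis-corrected) sampling algorithms for lattice gauge theory;
figures of merit are autocorrelation/cost numbers at stated couplings and volumes; no
continuum-physics claim.

Venture `LatticeQCDFlow` (cell pub-lqcd), sub-topic `Scoring`; FANOUT row 5 (`s0-sun-a`), GEN-23.
NEW WORK of the cell (placement rule).  Row 5's one-plaquette column gives the `U(N)` partition function
`Z_N(x) = ∫_{U(N)} e^{x Re tr U} dU = det[I_{|i−j|}(x)]_{N×N}` for every `N` (`UNOnePlaquetteBesselDeterminant`),
the moment generating function of `Re tr U` (`OnePlaquetteHaarMGF`; first cumulants in `UNOnePlaquetteCumulants`,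
GEN-20/21: `∫|tr U|⁴ = 2`, `∫(Re tr U)⁴ = 3/4`).  This file computes ALL the even trace moments, for every `N` and
`n`, WITHOUT Weingarten calculus or Schur–Weyl duality, and draws the consequences for the small-`x` expansion:

* §1 **`∫_{U(N)} |tr U|^{2n} dU = Σ_{μ ⊢ n, ℓ(μ) ≤ N} (f^μ)²`** (`integral_haar_unitaryGroup_norm_trace_pow`), the
  number of pairs of standard Young tableaux of one shape with `n` boxes and at most `N` rows: Weyl's
  integration formula in class-function form (the tree's `lintegral_unitaryGroup_eq_angleIntegral`), the
  angle integrand being `|(a_ρ p_1^n)(e^{iθ})|²` (`TorusParsevalAlternant`), Parseval on the torus, and the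
  coefficient identity of `AlternantPowerSumCoefficients`.  This is the moment identity of
  Diaconis–Shahshahani (1994, Thm. 2, for `N ≥ 2n`) and Rains (1998, Thm. 1.1: all `N`, `n`, the right-hand
  side being the number of permutations of `n` letters with no increasing subsequence longer than `N`).
  In particular **`∫_{U(N)} |tr U|^{2n} dU = n!` for `n ≤ N`** (`…_eq_factorial`, the moments of a standard
  complex Gaussian), **`≤ n!` for all `N`, `n`** (`…_le_factorial`) and the first non-Gaussian moment
  **`∫_{U(N)} |tr U|^{2N+2} dU = (N+1)! − 1`** (`…_succ`, with `OneColumnTableaux`); THE SAME FOR `SU(N)`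
  (`integral_haar_specialUnitaryGroup_norm_trace_pow…`, through `TorusParsevalPairing`'s
  `∫_{SU(N)} |tr V|^{2n} dV = ∫_{U(N)} |tr U|^{2n} dU`).
* §2 with `UNTraceMomentsCentralPhase`: **`∫_{U(N)} (Re tr U)^{2m} dU = (2m)!/(4^m m!)` for `m ≤ N`**, `≤` always,
  odd moments `0` — the first `2N + 1` moments of `Re tr U` are those of a centred real Gaussian of variance `½`.
* §3 THE ONE-PLAQUETTE PARTITION FUNCTION (`Z_N^{(k)}(0) = ∫ (Re tr U)^k dU` and the moment series are in
  `UNTraceMomentsCentralPhase`): **`Z_N^{(2m)}(0) = (2m)!/(4^m m!)` for `m ≤ N` (independent of `N`) and `Z_N^{(2m+1)}(0) = 0`**: the Taylor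
  polynomial of degree `2N + 1` of `det[I_{|i−j|}(x)]_{N×N}` at `0` is that of `e^{x²/4}` — the strong-coupling
  expansion of the two-dimensional `U(N)` theory is Gaussian through order `2N + 1` — and EXACTLY through that
  order: **`Z_N^{(2N+2)}(0) = (2N+2)!/(4^{N+1}(N+1)!)·(1 − 1/(N+1)!)`** (`…_two_mul_succ`), i.e.
  `Z_N(x) = e^{x²/4} − (x/2)^{2N+2}/((N+1)!)² + O(x^{2N+4})` (Bars–Green 1979; Samuel 1980); term by term in the
  moment series,
  **`det[I_{|i−j|}(x)]_{N×N} ≤ e^{x²/4}` for every `N` and real `x`** (`det_besselI_toeplitz_le_exp`), sharpened to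
  the two-sided sandwich **`0 ≤ e^{x²/4} − det[I_{|i−j|}(x)]_{N×N} ≤ (x²/4)^{N+1} e^{x²/4}/(N+1)!`**
  (`exp_sub_det_besselI_toeplitz_mem_Icc`: so `Z_N = e^{x²/4} + O(x^{2N+2})` at `0`, and
  `tendsto_det_besselI_toeplitz_atTop`: **`Z_N(x) → e^{x²/4}` as `N → ∞` for each fixed `x`**); in the
  vocabulary of the barrier file `Literature/Barriers/QuantumFields/GrossWittenTransition`:
  `G_n(γ) ≤ e^{n²γ²/4}` and **`f_n(γ) ≤ γ²/4 = gwStrong γ` for every `n ≥ 1` and every `γ`**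
  (`gwFreeEnergyN_le_gwStrong`) — at every finite `n` the free energy lies below the Gross–Witten
  strong-coupling branch that Johansson's Lemma 2.1 (the tree's named fact `GrossWittenLargeNFreeEnergy`)
  identifies as its `n → ∞` limit for `γ ≤ 1`.
References (context only; all proved from the tree and Mathlib): Diaconis–Shahshahani, J. Appl. Probab. 31A
(1994) 49, Thm. 2; Rains, Electron. J. Combin. 5 (1998) R12; Bars–Green, Phys. Rev. D 20 (1979) 3311; Samuel,
J. Math. Phys. 21 (1980) 2695; Johansson, Math. Res. Lett. 5 (1998) 63, Lemma 2.1.  No `def`, no named fact, 0 sorry.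
-/

noncomputable section

open Real MeasureTheory Finset Complex Equiv ProbabilityTheory
open scoped ENNReal ComplexConjugate
open Literature.MathematicalPhysics.QuantumFieldTheory (haarProbability)
open Literature.RepresentationTheory.CompactGroups.WeylIntegration
open Literature.RingTheory.SymmetricFunctions.SymmPoly (alternant rho)
open Literature.NumberTheory.DiophantineGeometry (numStandardTableaux)
open Literature.Analysis.FunctionSpaces
open Literature.Barriers.QuantumFields (gwPartitionFunction gwFreeEnergyN gwStrong)

namespace Summit.Ventures.LatticeQCDFlow.Scoring

variable {N : ℕ}

/-! ### 1. The even trace moments of a Haar unitary -/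

/-- **THE EVEN TRACE MOMENTS OF A HAAR UNITARY, `ℝ≥0∞` FORM**: `∫⁻_{U(N)} |tr U|^{2n} dU = Σ_{μ ⊢ n, ℓ(μ) ≤ N} (f^μ)²`
(Weyl's integration formula, Parseval on the torus for `a_ρ · p_1^n`, and `AlternantPowerSumCoefficients`). -/
theorem lintegral_haar_unitaryGroup_norm_trace_pow (N n : ℕ) :
    ∫⁻ u, ENNReal.ofReal (‖((u : Matrix.unitaryGroup (Fin N) ℂ) : Matrix (Fin N) (Fin N) ℂ).trace‖ ^ (2 * n))
        ∂(haarProbability (Matrix.unitaryGroup (Fin N) ℂ))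
      = ((∑ μ ∈ univ.filter (fun μ : Nat.Partition n => μ.parts.card ≤ N), numStandardTableaux μ ^ 2 : ℕ) : ℝ≥0∞) := by
  have hF : Measurable fun u : Matrix.unitaryGroup (Fin N) ℂ =>
      ENNReal.ofReal (‖((u : Matrix.unitaryGroup (Fin N) ℂ) : Matrix (Fin N) (Fin N) ℂ).trace‖ ^ (2 * n)) :=
    ENNReal.measurable_ofReal.comp
      (((continuous_id.matrix_trace.comp continuous_subtype_val).norm.pow _).measurable)
  have hcl : ∀ g u : Matrix.unitaryGroup (Fin N) ℂ,
      ENNReal.ofReal (‖(((g * u * g⁻¹ : Matrix.unitaryGroup (Fin N) ℂ)) : Matrix (Fin N) (Fin N) ℂ).trace‖ ^ (2 * n))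
        = ENNReal.ofReal (‖((u : Matrix.unitaryGroup (Fin N) ℂ) : Matrix (Fin N) (Fin N) ℂ).trace‖ ^ (2 * n)) := by
    intro g u
    rw [trace_conj_unitaryGroup]
  rw [lintegral_unitaryGroup_eq_angleIntegral hF hcl, angleIntegral]
  simp_rw [trace_torusPt]
  rw [show (volume : Measure (Fin N → ℝ)).restrict (Set.pi Set.univ fun _ => Set.Ioc (-π) π) =
    Measure.pi fun _ : Fin N => (volume : Measure ℝ).restrict (Set.Ioc (-π) π) from Measure.restrict_pi_pi _ _]
  have hprod : ∀ θ : Fin N → ℝ, ENNReal.ofReal (‖∑ b, cexp (θ b * I)‖ ^ (2 * n)) *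
      ENNReal.ofReal (∏ p : OD (Fin N), ‖cexp (θ p.1.1 * I) - cexp (θ p.1.2 * I)‖ ^ 2)
      = ENNReal.ofReal (‖∑ b, cexp (θ b * I)‖ ^ (2 * n) *
          ∏ p : OD (Fin N), ‖cexp (θ p.1.1 * I) - cexp (θ p.1.2 * I)‖ ^ 2) := fun θ =>
    (ENNReal.ofReal_mul (pow_nonneg (norm_nonneg _) _)).symm
  simp_rw [hprod]
  rw [← ofReal_integral_eq_lintegral_ofReal (integrable_cube_norm_sum_cexp_pow_mul_prod n)
    (Filter.Eventually.of_forall fun θ => mul_nonneg (pow_nonneg (norm_nonneg _) _)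
      (Finset.prod_nonneg fun p _ => sq_nonneg _))]
  simp_rw [← norm_sq_eval₂_alternant_mul_psum_pow]
  rw [integral_cube_norm_sq_eval₂_real]
  have hK : ∑ d ∈ (alternant (fun i => (MvPolynomial.X i : MvPolynomial (Fin N) ℤ)) (rho N) *
        MvPolynomial.psum (Fin N) ℤ 1 ^ n).support,
      ((MvPolynomial.coeff d (alternant (fun i => (MvPolynomial.X i : MvPolynomial (Fin N) ℤ)) (rho N) *
        MvPolynomial.psum (Fin N) ℤ 1 ^ n) : ℤ) : ℝ) ^ 2
      = (N.factorial : ℝ) *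
        ((∑ μ ∈ univ.filter (fun μ : Nat.Partition n => μ.parts.card ≤ N), numStandardTableaux μ ^ 2 : ℕ) : ℝ) := by
    have h := sum_support_coeff_sq_alternant_mul_psum_pow (N := N) n
    have h' := congrArg (Int.cast : ℤ → ℝ) h
    push_cast at h' ⊢
    exact h'
  rw [hK, ← mul_assoc, ENNReal.ofReal_mul (p := (2 * π) ^ N * (N.factorial : ℝ)) (by positivity),
    show ENNReal.ofReal ((2 * π) ^ N * (N.factorial : ℝ)) = ENNReal.ofReal (2 * π) ^ Fintype.card (Fin N) *
      ((Fintype.card (Fin N)).factorial : ℝ≥0∞) by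
      rw [Fintype.card_fin, ENNReal.ofReal_mul (by positivity), ENNReal.ofReal_pow Real.two_pi_pos.le,
        ENNReal.ofReal_natCast],
    ← mul_assoc, ENNReal.inv_mul_cancel (mul_ne_zero (pow_ne_zero _ (ENNReal.ofReal_pos.2 Real.two_pi_pos).ne')
      (Nat.cast_ne_zero.2 (Nat.factorial_ne_zero _))) (ENNReal.mul_ne_top (ENNReal.pow_ne_top ENNReal.ofReal_ne_top)
      (ENNReal.natCast_ne_top _)), one_mul, ENNReal.ofReal_natCast]

/-- **THE EVEN TRACE MOMENTS OF A HAAR UNITARY ARE TABLEAU COUNTS** (the Diaconis–Shahshahani / Rains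
moment identity in tableau form): for every `N` and `n`,
`∫_{U(N)} |tr U|^{2n} dU = Σ_{μ ⊢ n, ℓ(μ) ≤ N} (f^μ)²`,
the number of pairs of standard Young tableaux of the same shape with `n` boxes and at most `N` rows
(normalised Haar measure). -/
theorem integral_haar_unitaryGroup_norm_trace_pow (N n : ℕ) :
    ∫ u, ‖((u : Matrix.unitaryGroup (Fin N) ℂ) : Matrix (Fin N) (Fin N) ℂ).trace‖ ^ (2 * n)
        ∂(haarProbability (Matrix.unitaryGroup (Fin N) ℂ))
      = ((∑ μ ∈ univ.filter (fun μ : Nat.Partition n => μ.parts.card ≤ N), numStandardTableaux μ ^ 2 : ℕ) : ℝ) := by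
  have hc : Continuous fun u : Matrix.unitaryGroup (Fin N) ℂ =>
      ‖((u : Matrix.unitaryGroup (Fin N) ℂ) : Matrix (Fin N) (Fin N) ℂ).trace‖ ^ (2 * n) :=
    (continuous_id.matrix_trace.comp continuous_subtype_val).norm.pow _
  rw [integral_eq_lintegral_of_nonneg_ae (Filter.Eventually.of_forall fun u => pow_nonneg (norm_nonneg _) _)
    hc.aestronglyMeasurable, lintegral_haar_unitaryGroup_norm_trace_pow, ENNReal.toReal_natCast]

/-- **`∫_{U(N)} |tr U|^{2n} dU = n!` FOR `n ≤ N`**: the `2n`-th moment of the trace of a Haar unitary is the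
`2n`-th moment `n!` of a standard complex Gaussian as soon as `N ≥ n` (Diaconis–Shahshahani 1994, Thm. 2, for
`N ≥ 2n`; Rains 1998 for `N ≥ n`) — here from `Σ_{μ ⊢ n} (f^μ)² = n!` (every `μ ⊢ n` has at most `n ≤ N` parts). -/
theorem integral_haar_unitaryGroup_norm_trace_pow_eq_factorial {N n : ℕ} (h : n ≤ N) :
    ∫ u, ‖((u : Matrix.unitaryGroup (Fin N) ℂ) : Matrix (Fin N) (Fin N) ℂ).trace‖ ^ (2 * n)
        ∂(haarProbability (Matrix.unitaryGroup (Fin N) ℂ)) = n.factorial := by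
  rw [integral_haar_unitaryGroup_norm_trace_pow, sum_filter_sq_numStandardTableaux_eq h]

/-- **`∫_{U(N)} |tr U|^{2n} dU ≤ n!` FOR EVERY `N` AND `n`** (the moments of a standard complex Gaussian). -/
theorem integral_haar_unitaryGroup_norm_trace_pow_le_factorial (N n : ℕ) :
    ∫ u, ‖((u : Matrix.unitaryGroup (Fin N) ℂ) : Matrix (Fin N) (Fin N) ℂ).trace‖ ^ (2 * n)
        ∂(haarProbability (Matrix.unitaryGroup (Fin N) ℂ)) ≤ n.factorial := by
  rw [integral_haar_unitaryGroup_norm_trace_pow]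
  exact_mod_cast sum_filter_sq_numStandardTableaux_le N n

/-- **THE FIRST NON-GAUSSIAN TRACE MOMENT**: `∫_{U(N)} |tr U|^{2N+2} dU = (N+1)! − 1` — at `n = N + 1` exactly
the one-column shape is excluded from the tableau count, and it has one standard tableau (`OneColumnTableaux`). -/
theorem integral_haar_unitaryGroup_norm_trace_pow_succ (N : ℕ) :
    ∫ u, ‖((u : Matrix.unitaryGroup (Fin N) ℂ) : Matrix (Fin N) (Fin N) ℂ).trace‖ ^ (2 * (N + 1))
        ∂(haarProbability (Matrix.unitaryGroup (Fin N) ℂ)) = ((N + 1).factorial : ℝ) - 1 := by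
  rw [integral_haar_unitaryGroup_norm_trace_pow, sum_filter_sq_numStandardTableaux_succ,
    Nat.cast_sub (Nat.factorial_pos _), Nat.cast_one]

/-- **`∫_{SU(N)} |tr V|^{2n} dV = Σ_{μ ⊢ n, ℓ(μ) ≤ N} (f^μ)²`** for every `N` and `n`. -/
theorem integral_haar_specialUnitaryGroup_norm_trace_pow (N n : ℕ) :
    ∫ V, ‖((V : Matrix.specialUnitaryGroup (Fin N) ℂ) : Matrix (Fin N) (Fin N) ℂ).trace‖ ^ (2 * n)
        ∂(haarProbability (Matrix.specialUnitaryGroup (Fin N) ℂ))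
      = ((∑ μ ∈ univ.filter (fun μ : Nat.Partition n => μ.parts.card ≤ N), numStandardTableaux μ ^ 2 : ℕ) : ℝ) := by
  rw [integral_haar_specialUnitaryGroup_norm_trace_pow_eq, integral_haar_unitaryGroup_norm_trace_pow]

/-- **`∫_{SU(N)} |tr V|^{2n} dV = n!` FOR `n ≤ N`** (so `∫_{SU(3)} |tr V|² = 1`, `∫_{SU(3)} |tr V|⁴ = 2`,
`∫_{SU(3)} |tr V|⁶ = 6`). -/
theorem integral_haar_specialUnitaryGroup_norm_trace_pow_eq_factorial {N n : ℕ} (h : n ≤ N) :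
    ∫ V, ‖((V : Matrix.specialUnitaryGroup (Fin N) ℂ) : Matrix (Fin N) (Fin N) ℂ).trace‖ ^ (2 * n)
        ∂(haarProbability (Matrix.specialUnitaryGroup (Fin N) ℂ)) = n.factorial := by
  rw [integral_haar_specialUnitaryGroup_norm_trace_pow_eq, integral_haar_unitaryGroup_norm_trace_pow_eq_factorial h]

/-- `∫_{SU(N)} |tr V|^{2n} dV ≤ n!` for every `N` and `n`. -/
theorem integral_haar_specialUnitaryGroup_norm_trace_pow_le_factorial (N n : ℕ) :
    ∫ V, ‖((V : Matrix.specialUnitaryGroup (Fin N) ℂ) : Matrix (Fin N) (Fin N) ℂ).trace‖ ^ (2 * n)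
        ∂(haarProbability (Matrix.specialUnitaryGroup (Fin N) ℂ)) ≤ n.factorial := by
  rw [integral_haar_specialUnitaryGroup_norm_trace_pow_eq]
  exact integral_haar_unitaryGroup_norm_trace_pow_le_factorial N n

/-! ### 2. The first `2N + 1` moments of `Re tr U` are Gaussian -/

/-- **`∫_{U(N)} (Re tr U)^{2m} dU = (2m)!/(4^m m!)` FOR `m ≤ N`** — the `2m`-th moment of a centred real
Gaussian of variance `½` (equivalently the `2m`-th Taylor coefficient of `e^{x²/4}` times `(2m)!`). -/
theorem integral_re_trace_pow_even_eq {N m : ℕ} (h : m ≤ N) :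
    ∫ U, ((U : Matrix (Fin N) (Fin N) ℂ)).trace.re ^ (2 * m)
        ∂(haarProbability (Matrix.unitaryGroup (Fin N) ℂ))
      = ((2 * m).factorial : ℝ) / (4 ^ m * m.factorial) := by
  rw [integral_re_trace_pow_even, integral_haar_unitaryGroup_norm_trace_pow_eq_factorial h,
    choose_two_mul_div_mul_factorial]

/-- **`∫_{U(N)} (Re tr U)^{2m} dU ≤ (2m)!/(4^m m!)` for every `N` and `m`.** -/
theorem integral_re_trace_pow_even_le (N m : ℕ) :
    ∫ U, ((U : Matrix (Fin N) (Fin N) ℂ)).trace.re ^ (2 * m)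
        ∂(haarProbability (Matrix.unitaryGroup (Fin N) ℂ))
      ≤ ((2 * m).factorial : ℝ) / (4 ^ m * m.factorial) := by
  rw [integral_re_trace_pow_even]
  have hm : (m.factorial : ℝ) ≠ 0 := by positivity
  calc ((2 * m).choose m : ℝ) / 4 ^ m * ∫ U, ‖((U : Matrix (Fin N) (Fin N) ℂ)).trace‖ ^ (2 * m)
        ∂(haarProbability (Matrix.unitaryGroup (Fin N) ℂ))
      ≤ ((2 * m).choose m : ℝ) / 4 ^ m * m.factorial :=
        mul_le_mul_of_nonneg_left (integral_haar_unitaryGroup_norm_trace_pow_le_factorial N m) (by positivity)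
    _ = ((2 * m).factorial : ℝ) / (4 ^ m * m.factorial) := choose_two_mul_div_mul_factorial m

/-- **`∫_{U(N)} (Re tr U)^{2N+2} dU = (2N+2)!/(4^{N+1}(N+1)!) · (1 − 1/(N+1)!)`** — the first moment of `Re tr U`
that differs from the Gaussian value, by the relative amount `1/(N+1)!`. -/
theorem integral_re_trace_pow_two_mul_succ (N : ℕ) :
    ∫ U, ((U : Matrix (Fin N) (Fin N) ℂ)).trace.re ^ (2 * (N + 1))
        ∂(haarProbability (Matrix.unitaryGroup (Fin N) ℂ))
      = ((2 * (N + 1)).factorial : ℝ) / (4 ^ (N + 1) * (N + 1).factorial) * (1 - 1 / (N + 1).factorial) := by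
  rw [integral_re_trace_pow_even, integral_haar_unitaryGroup_norm_trace_pow_succ, ← choose_two_mul_div_mul_factorial]
  have h : ((N + 1).factorial : ℝ) ≠ 0 := by positivity
  field_simp

/-! ### 3. The `U(N)` one-plaquette partition function: Gaussian through order `2N + 1`, and bounded by `e^{x²/4}` -/

/-- **ODD TAYLOR COEFFICIENTS VANISH**: `Z_N^{(2m+1)}(0) = 0` (the determinant is even in `x`). -/
theorem iteratedDeriv_det_besselI_toeplitz_zero_odd (N m : ℕ) :
    iteratedDeriv (2 * m + 1) (fun x : ℝ => (Matrix.of fun i j : Fin N => besselI ((i : ℤ) - (j : ℤ)).natAbs x).det) 0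
      = 0 := by
  rw [iteratedDeriv_det_besselI_toeplitz_zero, integral_re_trace_pow_odd]

/-- **THE STRONG-COUPLING EXPANSION OF 2-d `U(N)` LATTICE GAUGE THEORY IS GAUSSIAN THROUGH ORDER `2N + 1`**:
for `m ≤ N`, `Z_N^{(2m)}(0) = (2m)!/(4^m m!)` — the `2m`-th derivative at `0` of `e^{x²/4}`, INDEPENDENT OF `N`;
together with the vanishing odd derivatives, the Taylor polynomial of degree `2N + 1` of
`Z_N(x) = ∫_{U(N)} e^{x Re tr U} dU = det[I_{|i−j|}(x)]_{N×N}` at `x = 0` is that of `e^{x²/4}`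
(Bars–Green 1979; Samuel 1980: the first deviation is the order-`x^{2N+2}` term). -/
theorem iteratedDeriv_det_besselI_toeplitz_zero_even {N m : ℕ} (h : m ≤ N) :
    iteratedDeriv (2 * m) (fun x : ℝ => (Matrix.of fun i j : Fin N => besselI ((i : ℤ) - (j : ℤ)).natAbs x).det) 0
      = ((2 * m).factorial : ℝ) / (4 ^ m * m.factorial) := by
  rw [iteratedDeriv_det_besselI_toeplitz_zero, integral_re_trace_pow_even_eq h]

/-- **THE FIRST NON-GAUSSIAN TAYLOR COEFFICIENT OF THE `U(N)` ONE-PLAQUETTE PARTITION FUNCTION**: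
`Z_N^{(2N+2)}(0) = (2N+2)!/(4^{N+1}(N+1)!) · (1 − 1/(N+1)!)`, i.e.
`det[I_{|i−j|}(x)]_{N×N} = e^{x²/4} − (x/2)^{2N+2}/((N+1)!)² + O(x^{2N+4})` at `x = 0` (Samuel 1980: the order at
which the finite-`N` theory departs from its `N = ∞` strong-coupling form). -/
theorem iteratedDeriv_det_besselI_toeplitz_zero_two_mul_succ (N : ℕ) :
    iteratedDeriv (2 * (N + 1)) (fun x : ℝ => (Matrix.of fun i j : Fin N => besselI ((i : ℤ) - (j : ℤ)).natAbs x).det) 0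
      = ((2 * (N + 1)).factorial : ℝ) / (4 ^ (N + 1) * (N + 1).factorial) * (1 - 1 / (N + 1).factorial) := by
  rw [iteratedDeriv_det_besselI_toeplitz_zero, integral_re_trace_pow_two_mul_succ]

/-- **`Z_N(x) ≤ e^{x²/4}` FOR EVERY `N` AND EVERY REAL `x`**: the `U(N)` one-plaquette partition function
`∫_{U(N)} e^{x Re tr U} dU = det[I_{|i−j|}(x)]_{N×N}` is bounded by the moment generating function of a centred
Gaussian of variance `½` — term by term, `∫(Re tr U)^{2m} ≤ (2m)!/(4^m m!)` and the odd moments vanish. -/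
theorem det_besselI_toeplitz_le_exp (N : ℕ) (x : ℝ) :
    (Matrix.of fun i j : Fin N => besselI ((i : ℤ) - (j : ℤ)).natAbs x).det ≤ Real.exp (x ^ 2 / 4) := by
  have hZ := hasSum_integral_re_trace_pow N x
  -- the Gaussian series, spread over all indices (zero at the odd ones)
  set b : ℕ → ℝ := fun k => if Even k then (x ^ 2 / 4) ^ (k / 2) / (k / 2).factorial else 0 with hb
  have hE : HasSum b (Real.exp (x ^ 2 / 4) + 0) := by
    refine HasSum.even_add_odd ?_ ?_
    · have h := NormedSpace.expSeries_div_hasSum_exp (x ^ 2 / 4)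
      rw [← Real.exp_eq_exp_ℝ] at h
      rw [show (fun k : ℕ => b (2 * k)) = fun n : ℕ => (x ^ 2 / 4) ^ n / n.factorial from funext fun k => by
        rw [hb]; dsimp only; rw [if_pos (even_two_mul k), Nat.mul_div_cancel_left k two_pos]]
      exact h
    · rw [show (fun k : ℕ => b (2 * k + 1)) = fun _ => 0 from funext fun k => by
        rw [hb]; dsimp only; rw [if_neg (Nat.not_even_iff_odd.mpr (odd_two_mul_add_one k))]]
      exact hasSum_zero
  rw [← add_zero (Real.exp (x ^ 2 / 4))]
  refine hasSum_le (fun k => ?_) hZ hE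
  rcases Nat.even_or_odd k with ⟨m, rfl⟩ | ⟨m, rfl⟩
  · rw [hb]; dsimp only
    rw [if_pos ⟨m, rfl⟩, ← two_mul, Nat.mul_div_cancel_left m two_pos]
    calc x ^ (2 * m) / ((2 * m).factorial : ℝ) *
          ∫ U, ((U : Matrix (Fin N) (Fin N) ℂ)).trace.re ^ (2 * m) ∂(haarProbability (Matrix.unitaryGroup (Fin N) ℂ))
        ≤ x ^ (2 * m) / ((2 * m).factorial : ℝ) * (((2 * m).factorial : ℝ) / (4 ^ m * m.factorial)) :=
          mul_le_mul_of_nonneg_left (integral_re_trace_pow_even_le N m)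
            (div_nonneg (by rw [pow_mul]; positivity) (Nat.cast_nonneg _))
      _ = (x ^ 2 / 4) ^ m / m.factorial := by
          have h1 : ((2 * m).factorial : ℝ) ≠ 0 := by positivity
          rw [div_pow, pow_mul]
          field_simp
  · rw [hb]; dsimp only
    rw [if_neg (Nat.not_even_iff_odd.mpr (odd_two_mul_add_one m)), integral_re_trace_pow_odd, mul_zero]

/-- **TWO-SIDED GAUSSIAN SANDWICH OF THE `U(N)` ONE-PLAQUETTE PARTITION FUNCTION**: for every `N` and real `x`,
`0 ≤ e^{x²/4} − det[I_{|i−j|}(x)]_{N×N} ≤ (x²/4)^{N+1}/(N+1)! · e^{x²/4}` — the moment series of `Z_N` and the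
Taylor series of `e^{x²/4}` agree through order `2N + 1`, the remaining Gaussian terms dominate those of `Z_N`
term by term, and the Gaussian tail beyond order `2N + 1` is at most `(x²/4)^{N+1}/(N+1)!` times the whole
series.  In particular `Z_N(x) = e^{x²/4} + O(x^{2N+2})` at `x = 0` and `Z_N(x) → e^{x²/4}` as `N → ∞` for
each fixed `x`. -/
theorem exp_sub_det_besselI_toeplitz_mem_Icc (N : ℕ) (x : ℝ) :
    Real.exp (x ^ 2 / 4) - (Matrix.of fun i j : Fin N => besselI ((i : ℤ) - (j : ℤ)).natAbs x).det
      ∈ Set.Icc 0 ((x ^ 2 / 4) ^ (N + 1) / (N + 1).factorial * Real.exp (x ^ 2 / 4)) := by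
  refine ⟨sub_nonneg.mpr (det_besselI_toeplitz_le_exp N x), ?_⟩
  have hZ := hasSum_integral_re_trace_pow N x
  set a : ℕ → ℝ := fun k => x ^ k / k.factorial *
    ∫ U, ((U : Matrix (Fin N) (Fin N) ℂ)).trace.re ^ k ∂(haarProbability (Matrix.unitaryGroup (Fin N) ℂ)) with ha
  set b : ℕ → ℝ := fun k => if Even k then (x ^ 2 / 4) ^ (k / 2) / (k / 2).factorial else 0 with hb
  have hb2 : ∀ j, b (2 * j) = (x ^ 2 / 4) ^ j / j.factorial := fun j => by
    rw [hb]; dsimp only; rw [if_pos (even_two_mul j), Nat.mul_div_cancel_left j two_pos]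
  have hb1 : ∀ j, b (2 * j + 1) = 0 := fun j => by
    rw [hb]; dsimp only; rw [if_neg (Nat.not_even_iff_odd.mpr (odd_two_mul_add_one j))]
  have hE : HasSum b (Real.exp (x ^ 2 / 4)) := by
    have h := NormedSpace.expSeries_div_hasSum_exp (x ^ 2 / 4)
    rw [← Real.exp_eq_exp_ℝ] at h
    have h2 : HasSum (fun k : ℕ => b (2 * k)) (Real.exp (x ^ 2 / 4)) := by
      rw [show (fun k : ℕ => b (2 * k)) = fun n : ℕ => (x ^ 2 / 4) ^ n / n.factorial from funext hb2]; exact h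
    have h1 : HasSum (fun k : ℕ => b (2 * k + 1)) 0 := by
      rw [show (fun k : ℕ => b (2 * k + 1)) = fun _ => 0 from funext hb1]; exact hasSum_zero
    simpa using h2.even_add_odd h1
  -- agreement through order `2N + 1` and termwise domination
  have hab_eq : ∀ k, k < 2 * N + 2 → a k = b k := by
    intro k hk
    rcases Nat.even_or_odd k with ⟨m, rfl⟩ | ⟨m, rfl⟩
    · rw [← two_mul] at hk ⊢
      rw [hb2, ha]; dsimp only
      rw [integral_re_trace_pow_even_eq (show m ≤ N by omega), div_pow, pow_mul]
      have h1 : ((2 * m).factorial : ℝ) ≠ 0 := by positivity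
      field_simp
    · rw [hb1, ha]; dsimp only
      rw [integral_re_trace_pow_odd, mul_zero]
  have hab_le : ∀ k, a k ≤ b k := by
    intro k
    rcases Nat.even_or_odd k with ⟨m, rfl⟩ | ⟨m, rfl⟩
    · rw [← two_mul, hb2, ha]; dsimp only
      calc x ^ (2 * m) / ((2 * m).factorial : ℝ) *
            ∫ U, ((U : Matrix (Fin N) (Fin N) ℂ)).trace.re ^ (2 * m) ∂(haarProbability (Matrix.unitaryGroup (Fin N) ℂ))
          ≤ x ^ (2 * m) / ((2 * m).factorial : ℝ) * (((2 * m).factorial : ℝ) / (4 ^ m * m.factorial)) :=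
            mul_le_mul_of_nonneg_left (integral_re_trace_pow_even_le N m)
              (div_nonneg (by rw [pow_mul]; positivity) (Nat.cast_nonneg _))
        _ = (x ^ 2 / 4) ^ m / m.factorial := by
            have h1 : ((2 * m).factorial : ℝ) ≠ 0 := by positivity
            rw [div_pow, pow_mul]
            field_simp
    · rw [hb1, ha]; dsimp only
      rw [integral_re_trace_pow_odd, mul_zero]
  -- the Gaussian tail beyond order `2N + 1`
  have htail : ∀ i, b (i + (2 * N + 2)) ≤ (x ^ 2 / 4) ^ (N + 1) / (N + 1).factorial * b i := by
    intro i
    rcases Nat.even_or_odd i with ⟨m, rfl⟩ | ⟨m, rfl⟩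
    · rw [← two_mul, show 2 * m + (2 * N + 2) = 2 * (m + (N + 1)) by ring, hb2, hb2, pow_add,
        div_mul_div_comm, mul_comm ((x ^ 2 / 4) ^ m)]
      refine div_le_div_of_nonneg_left (by positivity) (by positivity) ?_
      have h := Nat.factorial_mul_factorial_dvd_factorial_add (N + 1) m
      rw [show N + 1 + m = m + (N + 1) by ring] at h
      exact_mod_cast Nat.le_of_dvd (Nat.factorial_pos _) h
    · rw [show 2 * m + 1 + (2 * N + 2) = 2 * (m + N + 1) + 1 by ring, hb1, hb1, mul_zero]
  -- assemble: `e − Z = Σ_{k ≥ 2N+2} (b_k − a_k) ≤ Σ_i b_{i+2N+2} ≤ tail · e`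
  have hd : HasSum (fun i => b (i + (2 * N + 2)) - a (i + (2 * N + 2)))
      (Real.exp (x ^ 2 / 4) - (Matrix.of fun i j : Fin N => besselI ((i : ℤ) - (j : ℤ)).natAbs x).det) := by
    have h := (hasSum_nat_add_iff' (f := fun k => b k - a k) (2 * N + 2)).mpr (hE.sub hZ)
    rwa [Finset.sum_eq_zero (fun k hk => by rw [hab_eq k (Finset.mem_range.mp hk), sub_self]), sub_zero] at h
  have ht : HasSum (fun i => (x ^ 2 / 4) ^ (N + 1) / (N + 1).factorial * b i)
      ((x ^ 2 / 4) ^ (N + 1) / (N + 1).factorial * Real.exp (x ^ 2 / 4)) := hE.mul_left _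
  have ha0 : ∀ k, 0 ≤ a k := by
    intro k
    rcases Nat.even_or_odd k with ⟨m, rfl⟩ | ⟨m, rfl⟩
    · rw [← two_mul, ha]; dsimp only
      exact mul_nonneg (div_nonneg (by rw [pow_mul]; positivity) (Nat.cast_nonneg _))
        (integral_nonneg fun U => by rw [pow_mul]; positivity)
    · rw [ha]; dsimp only
      rw [integral_re_trace_pow_odd, mul_zero]
  exact hasSum_le (fun i => (sub_le_self _ (ha0 _)).trans (htail i)) hd ht

/-- **`Z_N(x) → e^{x²/4}` AS `N → ∞` FOR EVERY FIXED `x`** (from the sandwich: `(x²/4)^{N+1}/(N+1)! → 0`): at fixed,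
un-rescaled coupling the `U(N)` one-plaquette partition function tends to the Gaussian / `N = ∞` strong-coupling form. -/
theorem tendsto_det_besselI_toeplitz_atTop (x : ℝ) :
    Filter.Tendsto (fun N : ℕ => (Matrix.of fun i j : Fin N => besselI ((i : ℤ) - (j : ℤ)).natAbs x).det)
      Filter.atTop (nhds (Real.exp (x ^ 2 / 4))) := by
  have h0 : Filter.Tendsto (fun N : ℕ => (x ^ 2 / 4) ^ (N + 1) / (N + 1).factorial * Real.exp (x ^ 2 / 4))
      Filter.atTop (nhds (0 * Real.exp (x ^ 2 / 4))) :=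
    ((FloorSemiring.tendsto_pow_div_factorial_atTop (x ^ 2 / 4)).comp (Filter.tendsto_add_atTop_nat 1)).mul_const _
  rw [zero_mul] at h0
  have h1 : Filter.Tendsto (fun N : ℕ => Real.exp (x ^ 2 / 4) -
      (x ^ 2 / 4) ^ (N + 1) / (N + 1).factorial * Real.exp (x ^ 2 / 4)) Filter.atTop (nhds (Real.exp (x ^ 2 / 4))) := by
    simpa using (tendsto_const_nhds (x := Real.exp (x ^ 2 / 4))).sub h0
  refine tendsto_of_tendsto_of_tendsto_of_le_of_le h1 tendsto_const_nhds (fun N => ?_) (fun N => ?_)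
  · have h := (exp_sub_det_besselI_toeplitz_mem_Icc N x).2
    dsimp only
    linarith
  · exact det_besselI_toeplitz_le_exp N x

/-- **In the Gross–Witten barrier file's vocabulary**: Johansson's `G_n(γ) = ∫_{U(n)} e^{γ n Re tr U} dU` satisfies
`G_n(γ) ≤ e^{n²γ²/4}` for every `n` and `γ`. -/
theorem gwPartitionFunction_le_exp (n : ℕ) (γ : ℝ) :
    gwPartitionFunction n γ ≤ Real.exp ((γ * n) ^ 2 / 4) := by
  rw [gwPartitionFunction_eq_det]
  exact det_besselI_toeplitz_le_exp n (γ * n)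

/-- **THE FINITE-`n` FREE ENERGY NEVER EXCEEDS THE GROSS–WITTEN STRONG-COUPLING BRANCH**: for every `n ≥ 1`
and every real `γ`, `f_n(γ) = n⁻² log G_n(γ) ≤ γ²/4 = gwStrong γ` (the branch that Johansson's Lemma 2.1 —
the tree's named fact `GrossWittenLargeNFreeEnergy` — identifies as the `n → ∞` limit for `γ ≤ 1`). -/
theorem gwFreeEnergyN_le_gwStrong {n : ℕ} (hn : 1 ≤ n) (γ : ℝ) :
    gwFreeEnergyN n γ ≤ gwStrong γ := by
  rw [gwFreeEnergyN_eq_log_det, gwStrong]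
  have hpos := det_besselI_toeplitz_fin_pos n (γ * n)
  have hn' : (0 : ℝ) < (n : ℝ) ^ 2 := by positivity
  rw [div_le_iff₀ hn']
  calc Real.log ((Matrix.of fun i j : Fin n => besselI ((i : ℤ) - (j : ℤ)).natAbs (γ * n)).det)
      ≤ (γ * n) ^ 2 / 4 := (Real.log_le_iff_le_exp hpos).mpr (det_besselI_toeplitz_le_exp n (γ * n))
    _ = γ ^ 2 / 4 * (n : ℝ) ^ 2 := by ring

end Summit.Ventures.LatticeQCDFlow.Scoring
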